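import Literature.Topology.FourManifolds.FiniteHomogeneity
import Literature.Topology.FourManifolds.CoupleTwist

/-!
# Positions: a sphere diffeomorphism matching the core directions of a couple

Topic `Literature/Topology/FourManifolds` (support of `stmt-SmoothPoincare4-15190`, structure
conjugacy; step (ε2) of the construction of the sphere diffeomorphism).  Everything here is
**proved**.

* `Diffeomorph.exists_forall_apply_eq_of_injective` — **finite homogeneity**: on a connected
  Hausdorff manifold of dimension `≥ 2` two injective finite families of points `p`, `q` are
  matched by one diffeomorphism, `φ (p i) = q i` (induction on the family with Hirsch's
  homogeneity relative to a finite set, `Diffeomorph.exists_apply_eq_forall_eq_of_finite`);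
* `BasinCouple.SaddleData.exists_sphereDiffeo_coreDir` — for couple saddle data with boxes of
  index `1` there is `φ₀ : S² ≃ₘ S²` with
  `φ₀ (unit (coreDir_A s b)) = rad⁻¹ • coreDir_B (σ s) b` for all saddles `s` and ends `b` (the
  hypothesis `hφ0` of `EntranceTransitionMaps.lean`).

## References

* M. W. Hirsch, *Differential Topology*, GTM 33 (1976), Ch. 8 §3, Thm. 3.1 (`k = 0`).
  [HirschDT1976]
-/

open scoped Manifold ContDiff Topology
open Set Function Filter Metric Module

noncomputable section

namespace Literature.Topology.FourManifolds

/-! ### Finite homogeneity for injective families -/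

section Homogeneity

variable {E : Type*} [NormedAddCommGroup E] [InnerProductSpace ℝ E] [FiniteDimensional ℝ E]
  [CompleteSpace E]
  {M : Type*} [TopologicalSpace M] [ChartedSpace E M] [T2Space M] [ConnectedSpace M]
  [IsManifold 𝓘(ℝ, E) ∞ M]

/-- **Finite homogeneity**: two injective finite families of points of a connected manifold of
dimension `≥ 2` are matched by a diffeomorphism. [cite: HirschDT1976, Ch. 8 §3, Thm. 3.1 (k = 0)] -/
theorem Diffeomorph.exists_forall_apply_eq_of_injective (h2 : 1 < Module.finrank ℝ E) {ι : Type*} [Finite ι]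
    {p q : ι → M} (hp : Injective p) (hq : Injective q) :
    ∃ φ : M ≃ₘ⟮𝓘(ℝ, E), 𝓘(ℝ, E)⟯ M, ∀ i, φ (p i) = q i := by
  classical
  suffices h : ∀ s : Finset ι, ∃ φ : M ≃ₘ⟮𝓘(ℝ, E), 𝓘(ℝ, E)⟯ M, ∀ i ∈ s, φ (p i) = q i by
    haveI := Fintype.ofFinite ι
    obtain ⟨φ, hφ⟩ := h Finset.univ
    exact ⟨φ, fun i => hφ i (Finset.mem_univ i)⟩
  intro s
  induction s using Finset.induction_on with
  | empty => exact ⟨Diffeomorph.refl _ _ _, fun i hi => absurd hi (Finset.notMem_empty i)⟩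
  | @insert i s hi ih =>
    obtain ⟨φ, hφ⟩ := ih
    -- move `φ (p i)` to `q i` fixing the already matched `q j`, `j ∈ s`
    have hS : (q '' (s : Set ι)).Finite := (s.finite_toSet).image q
    have hx : φ (p i) ∉ q '' (s : Set ι) := by
      rintro ⟨j, hj, hji⟩
      have h1 : φ (p j) = φ (p i) := by rw [hφ j hj]; exact hji
      have h2 : j = i := hp (φ.injective h1)
      exact hi (h2 ▸ hj)
    have hy : q i ∉ q '' (s : Set ι) := by
      rintro ⟨j, hj, hji⟩
      exact hi (hq hji ▸ hj)
    obtain ⟨P, hPx, hPS⟩ := Diffeomorph.exists_apply_eq_forall_eq_of_finite h2 hS hx hy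
    refine ⟨φ.trans P, fun j hj => ?_⟩
    rcases Finset.mem_insert.1 hj with rfl | hj'
    · exact hPx
    · show P (φ (p j)) = q j
      rw [hφ j hj']
      exact hPS _ ⟨j, hj', rfl⟩

end Homogeneity

/-! ### The sphere `S²` -/

attribute [local instance] fact_finrank_euclideanSpace_succ

/-- **Finite homogeneity of `S²`** for injective finite families. [cite: HirschDT1976, Ch. 8 §3, Thm. 3.1 (k = 0)] -/
theorem sphere_two_exists_forall_apply_eq {ι : Type*} [Finite ι]
    {p q : ι → Metric.sphere (0 : EuclideanSpace ℝ (Fin 3)) 1} (hp : Injective p) (hq : Injective q) :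
    ∃ φ : Metric.sphere (0 : EuclideanSpace ℝ (Fin 3)) 1 ≃ₘ⟮𝓡 2, 𝓡 2⟯ Metric.sphere (0 : EuclideanSpace ℝ (Fin 3)) 1,
      ∀ i, φ (p i) = q i := by
  haveI := connectedSpace_sphere_two
  have h2 : 1 < Module.finrank ℝ (EuclideanSpace ℝ (Fin 2)) := by rw [finrank_euclideanSpace_fin]; norm_num
  exact Diffeomorph.exists_forall_apply_eq_of_injective h2 hp hq

/-! ### Positions for a couple -/

namespace BasinCouple.SaddleData

open Cobordism FourManifolds.Flow TracePolar

universe u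

variable {W : Type u} [TopologicalSpace W] [T2Space W] [SecondCountableTopology W]
  [CompactSpace W] [ChartedSpace (EuclideanHalfSpace (2 + 1)) W] [IsManifold (𝓡∂ (2 + 1)) ∞ W]
  {gA gB : W → ℝ} {ξA ξB : Π x : W, TangentSpace (𝓡∂ (2 + 1)) x} {C : BasinCouple gA gB ξA ξB}
  (Q : C.SaddleData)

/-- Local notation for the model space. -/
local notation "E3" => EuclideanSpace ℝ (Fin 3)

/-- The unit core directions of one datum form an injective family. [folklore] -/
theorem _root_.Literature.Topology.FourManifolds.BasinPair.SaddleData.unitVec_coreDir_injective {g : W → ℝ} {ξ ξ' : Π x : W, TangentSpace (𝓡∂ (2 + 1)) x} {P : BasinPair g ξ ξ'}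
    (Q₁ : P.SaddleData) (hk : ∀ s, (Q₁.DA s).k = 1) :
    Injective fun p : SaddlePt 2 g × Bool => unitVec (Q₁.coreDir p.1 p.2) := by
  rintro ⟨s, b⟩ ⟨s', b'⟩ h
  have hn : ∀ (s₀ : SaddlePt 2 g) (b₀ : Bool), ‖Q₁.coreDir s₀ b₀‖ = P.A.rad := fun s₀ b₀ => Q₁.norm_coreDir (hk s₀) b₀
  have hne : ∀ (s₀ : SaddlePt 2 g) (b₀ : Bool), Q₁.coreDir s₀ b₀ ≠ 0 := fun s₀ b₀ => by
    rw [← norm_ne_zero_iff, hn]; exact P.A.rad_pos.ne'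
  have h' : (unitVec (Q₁.coreDir s b) : E3) = unitVec (Q₁.coreDir s' b') := by
    simp only at h; rw [h]
  rw [coe_unitVec (hne s b), coe_unitVec (hne s' b'), hn, hn] at h'
  have h'' : Q₁.coreDir s b = Q₁.coreDir s' b' := smul_right_injective _ (inv_ne_zero P.A.rad_pos.ne') h'
  obtain ⟨rfl, rfl⟩ := Q₁.coreDir_injective hk h''
  rfl

/-- **Positions**: a diffeomorphism of `S²` mapping the unit core directions of `A` to those of `B`
along `σ`. [cite: HirschDT1976, Ch. 8 §3, Thm. 3.1 (k = 0)] -/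
theorem exists_sphereDiffeo_coreDir (hkA : ∀ s, (Q.QA.DA s).k = 1) (hkB : ∀ s', (Q.QB.DA s').k = 1) :
    ∃ φ₀ : Metric.sphere (0 : E3) 1 ≃ₘ⟮𝓡 2, 𝓡 2⟯ Metric.sphere (0 : E3) 1,
      ∀ (s : SaddlePt 2 gA) (b : Bool), (φ₀ (unitVec (Q.QA.coreDir s b)) : E3) = C.A.rad⁻¹ • Q.QB.coreDir (Q.σ s) b := by
  haveI : Finite (SaddlePt 2 gA) := C.A.finite_saddlePt
  have hp := Q.QA.unitVec_coreDir_injective hkA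
  have hqB := Q.QB.unitVec_coreDir_injective hkB
  -- the target family, reindexed along `σ`
  have hq : Injective fun p : SaddlePt 2 gA × Bool => unitVec (Q.QB.coreDir (Q.σ p.1) p.2) := by
    rintro ⟨s, b⟩ ⟨s', b'⟩ h
    have h1 := hqB (a₁ := (Q.σ s, b)) (a₂ := (Q.σ s', b')) h
    simp only [Prod.mk.injEq] at h1
    obtain ⟨h2, rfl⟩ := h1
    rw [Q.σ.injective h2]
  obtain ⟨φ₀, hφ₀⟩ := sphere_two_exists_forall_apply_eq hp hq
  refine ⟨φ₀, fun s b => ?_⟩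
  have h := hφ₀ (s, b)
  simp only at h
  rw [h]
  have hne : Q.QB.coreDir (Q.σ s) b ≠ 0 := by
    rw [← norm_ne_zero_iff, Q.QB.norm_coreDir (hkB _)]; exact C.B.rad_pos.ne'
  rw [coe_unitVec hne, Q.QB.norm_coreDir (hkB _)]
  show C.B.rad⁻¹ • Q.QB.coreDir (Q.σ s) b = C.A.rad⁻¹ • Q.QB.coreDir (Q.σ s) b
  rw [C.rad_eq]

end BasinCouple.SaddleData

end Literature.Topology.FourManifolds
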